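import Summits.NavierStokesRegularity.NavierStokesRegularity.Theorems.AdaptedKernelExists.Negative.UniformDriftKernel

/-!
# `AdaptedKernelExists` (stmt-NavierStokesRegularity-2956): the Galilean calibration kernel

Support lemmas for the crux `AdaptedFrequency.AdaptedKernelExists`, extracted from the crux work
file `Cruxes/AdaptedKernelExists/Disproof.lean` (cdisprove seat, cycle 1), §3.1. No conclusion
asserts a route item; these are small-model / calibration facts for the linear transfer target
`C⁺` of the crux's three lines.

The uniform drift `u = C e/√(T - t)` is a classical NS solution on `[0, T)`
(`isClassicalNSSolutionOn_gal`) with the EXACT Type-I rate (`norm_gal`, `isTypeIBlowup_gal`); its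
adapted kernel (file `UniformDriftKernel`) is the heat kernel recentred by `2C√(T - t) e`
(`isAdaptedBackwardKernel_gal`). Proved: two-sided Gaussian comparability with explicit constants
(`gal_two_sided`, `isGaussianComparable_gal`: `c₂ = 2ν`, `C₂ = 8ν`, `c₁/C₁ = e^{∓O(C²/ν)}`), the
pole value `(4πν(T - t))^{-3/2} e^{-C²‖e‖²/ν}` (`galKernel_pole`), and the exponential moments
`∫e^{⟪α,x-x₀⟫}Γ = exp(ν(T-t)‖α‖² - 2C√(T-t)⟪α,e⟫)` (`gal_expMoment`): the moment law of the picked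
line's `stub_expMoment` is ATTAINED along `e = -α/‖α‖` (`gal_expMoment_sharp`). Tightness and
refuted strengthenings are in `GalileanTightness`. [folklore]
-/

noncomputable section

namespace Summit.NavierStokesRegularity.NavierStokesRegularity.Theorems.AdaptedKernelExistsNegative.Galilean

open Set Filter Topology MeasureTheory Function
open scoped Laplacian InnerProductSpace RealInnerProductSpace ContDiff
open Literature.Analysis.FluidPDE Literature.Analysis

local notation "ℝ³" => EuclideanSpace ℝ (Fin 3)

open UniformDrift

variable {ν T C : ℝ} {x₀ e : ℝ³}


/-- Galilean amplitude `a(t) = C/√(T - t)`. -/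
def galAmp (C T : ℝ) (t : ℝ) : ℝ := C / Real.sqrt (T - t)

/-- Galilean displacement-to-come `D(t) = ∫ₜᵀ a = 2C√(T - t)`. -/
def galDisp (C T : ℝ) (t : ℝ) : ℝ := 2 * C * Real.sqrt (T - t)

/-- The Galilean adapted kernel: heat kernel recentred by `2C√(T - t) e`. -/
def galKernel (ν T : ℝ) (x₀ e : ℝ³) (C : ℝ) : ℝ → ℝ³ → ℝ :=
  recentredKernel ν T x₀ e (galDisp C T)

/-- The Galilean amplitude is smooth before `T`. [folklore] -/
theorem contDiffOn_galAmp (C T : ℝ) {n : WithTop ℕ∞} : ContDiffOn ℝ n (galAmp C T) (Iio T) :=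
  fun _ ht => (contDiffAt_const.div ((contDiffAt_const.sub contDiffAt_id).sqrt (sub_pos.2 ht).ne')
    (Real.sqrt_pos.2 (sub_pos.2 ht)).ne').contDiffWithinAt

/-- The Galilean displacement is smooth before `T`. [folklore] -/
theorem contDiffOn_galDisp (C T : ℝ) {n : WithTop ℕ∞} : ContDiffOn ℝ n (galDisp C T) (Iio T) :=
  fun _ ht => (contDiffAt_const.mul ((contDiffAt_const.sub contDiffAt_id).sqrt
    (sub_pos.2 ht).ne')).contDiffWithinAt

/-- `D' = -a` for the Galilean member. [folklore] -/
theorem hasDerivAt_galDisp (C : ℝ) {T t : ℝ} (ht : t < T) :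
    HasDerivAt (galDisp C T) (-(galAmp C T t)) t := by
  have hpos : 0 < T - t := sub_pos.2 ht
  have h1 : HasDerivAt (fun s : ℝ => Real.sqrt (T - s)) ((0 - 1) / (2 * Real.sqrt (T - t))) t :=
    ((hasDerivAt_const t T).sub (hasDerivAt_id t)).sqrt hpos.ne'
  have h2 := h1.const_mul (2 * C)
  refine h2.congr_deriv ?_
  have hsq : Real.sqrt (T - t) ≠ 0 := (Real.sqrt_pos.2 hpos).ne'
  simp only [galAmp]
  field_simp
  ring

/-- `D(t) → 0` as `t ↑ T` for the Galilean member. [folklore] -/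
theorem tendsto_galDisp (C T : ℝ) : Tendsto (galDisp C T) (𝓝[<] T) (𝓝 0) := by
  have hc : Continuous (galDisp C T) := by unfold galDisp; fun_prop
  have := hc.tendsto T
  simp only [galDisp, sub_self, Real.sqrt_zero, mul_zero] at this
  exact this.mono_left nhdsWithin_le_nhds

/-- **The Galilean drift carries an explicit adapted kernel** (every `ν > 0`, `C`, `e`). -/
theorem isAdaptedBackwardKernel_gal (hν : 0 < ν) (T : ℝ) (x₀ e : ℝ³) (C : ℝ) :
    IsAdaptedBackwardKernel ν (uniformVel (galAmp C T) e) (Iio T) T x₀ (galKernel ν T x₀ e C) :=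
  isAdaptedBackwardKernel_recentred hν T x₀ e (contDiffOn_galDisp C T)
    (fun _ ht => hasDerivAt_galDisp C ht) (tendsto_galDisp C T)

/-- The Galilean drift is a classical Navier–Stokes solution on `[0, T)` (every viscosity `μ`,
linear pressure). -/
theorem isClassicalNSSolutionOn_gal (μ C : ℝ) {T : ℝ} (e : ℝ³) :
    IsClassicalNSSolutionOn (Ico 0 T) μ 0 (uniformVel (galAmp C T) e)
      (uniformPres (derivWithin (galAmp C T) (Ico 0 T)) e) :=
  isClassicalNSSolutionOn_uniform (uniqueDiffOn_Ico 0 T)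
    ((contDiffOn_galAmp C T).mono Ico_subset_Iio_self) μ e

/-- The Galilean drift has EXACTLY the Type-I rate, constant `|C| ‖e‖`, at every `t < T`. -/
theorem norm_gal (C : ℝ) {T t : ℝ} (e x : ℝ³) :
    ‖uniformVel (galAmp C T) e t x‖ = |C| * ‖e‖ / Real.sqrt (T - t) := by
  simp only [uniformVel_apply, galAmp, norm_smul, norm_div, Real.norm_eq_abs,
    abs_of_nonneg (Real.sqrt_nonneg _)]
  ring

/-- The Galilean drift is Type-I at `T` (constant `|C| ‖e‖`). [folklore] -/
theorem isTypeIBlowup_gal (C T : ℝ) (e : ℝ³) : IsTypeIBlowup (uniformVel (galAmp C T) e) T :=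
  ⟨|C| * ‖e‖, Eventually.of_forall fun _ x => (norm_gal C e x).le⟩

/-- **On the diagonal** the Galilean kernel is the free kernel damped by EXACTLY `e^{-C²‖e‖²/ν}`:
`Γ(t, x₀) = (4πν)^{-3/2} (T - t)^{-3/2} e^{-C²‖e‖²/ν}`. -/
theorem galKernel_pole (hν : 0 < ν) {t : ℝ} (ht : t < T) :
    galKernel ν T x₀ e C t x₀ =
      (4 * Real.pi * ν) ^ (-(3 : ℝ) / 2) * (T - t) ^ (-(3 : ℝ) / 2) *
        Real.exp (-(C ^ 2 * ‖e‖ ^ 2 / ν)) := by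
  have hs : 0 < T - t := sub_pos.2 ht
  rw [galKernel, recentredKernel_closed_form hν.le x₀ e _ ht x₀, sub_self, zero_add]
  congr 2
  rw [norm_smul, mul_pow, Real.norm_eq_abs, sq_abs, galDisp, mul_pow, mul_pow, Real.sq_sqrt hs.le]
  field_simp
  ring

/-- Elementary: `‖a + b‖² ≤ 2‖a‖² + 2‖b‖²`. -/
theorem norm_add_sq_le_two_mul (a b : ℝ³) : ‖a + b‖ ^ 2 ≤ 2 * ‖a‖ ^ 2 + 2 * ‖b‖ ^ 2 := by
  nlinarith [norm_add_le a b, norm_nonneg a, norm_nonneg b, norm_nonneg (a + b),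
    sq_nonneg (‖a‖ - ‖b‖)]

/-- **Two-sided Gaussian bounds for the Galilean kernel with explicit constants**:
`c₁ = (4πν)^{-3/2} e^{-2C²‖e‖²/ν}`, `c₂ = 2ν`, `C₁ = (4πν)^{-3/2} e^{C²‖e‖²/ν}`, `C₂ = 8ν`. -/
theorem gal_two_sided (hν : 0 < ν) {t : ℝ} (ht : t < T) (x : ℝ³) :
    (4 * Real.pi * ν) ^ (-(3 : ℝ) / 2) * Real.exp (-(2 * C ^ 2 * ‖e‖ ^ 2 / ν)) *
          (T - t) ^ (-(3 : ℝ) / 2) * Real.exp (-(‖x - x₀‖ ^ 2) / (2 * ν * (T - t))) ≤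
        galKernel ν T x₀ e C t x ∧
      galKernel ν T x₀ e C t x ≤
        (4 * Real.pi * ν) ^ (-(3 : ℝ) / 2) * Real.exp (C ^ 2 * ‖e‖ ^ 2 / ν) *
          (T - t) ^ (-(3 : ℝ) / 2) * Real.exp (-(‖x - x₀‖ ^ 2) / (8 * ν * (T - t))) := by
  have hs : 0 < T - t := sub_pos.2 ht
  set s := T - t with hsdef
  set A : ℝ := (4 * Real.pi * ν) ^ (-(3 : ℝ) / 2) with hA
  have hApos : 0 < A := Real.rpow_pos_of_pos (by positivity) _
  have hspow : 0 < s ^ (-(3 : ℝ) / 2) := Real.rpow_pos_of_pos hs _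
  have hde : ‖galDisp C T t • e‖ ^ 2 = 4 * C ^ 2 * s * ‖e‖ ^ 2 := by
    rw [norm_smul, mul_pow, Real.norm_eq_abs, sq_abs, galDisp, mul_pow, mul_pow, Real.sq_sqrt hs.le]
    ring
  rw [galKernel, recentredKernel_closed_form hν.le x₀ e _ ht x]
  have hz : ‖x - x₀‖ ^ 2 ≤ 2 * ‖x - x₀ + galDisp C T t • e‖ ^ 2 + 2 * ‖galDisp C T t • e‖ ^ 2 := by
    have := norm_add_sq_le_two_mul (x - x₀ + galDisp C T t • e) (-(galDisp C T t • e))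
    rwa [add_neg_cancel_right, norm_neg] at this
  have hw : ‖x - x₀ + galDisp C T t • e‖ ^ 2 ≤ 2 * ‖x - x₀‖ ^ 2 + 2 * ‖galDisp C T t • e‖ ^ 2 :=
    norm_add_sq_le_two_mul _ _
  rw [hde] at hz hw
  constructor
  · -- lower bound
    have hexp : -(2 * C ^ 2 * ‖e‖ ^ 2 / ν) + -(‖x - x₀‖ ^ 2) / (2 * ν * s) ≤
        -(‖x - x₀ + galDisp C T t • e‖ ^ 2) / (4 * ν * s) := by
      rw [← sub_nonneg]
      have hkey : -(‖x - x₀ + galDisp C T t • e‖ ^ 2) / (4 * ν * s) -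
          (-(2 * C ^ 2 * ‖e‖ ^ 2 / ν) + -(‖x - x₀‖ ^ 2) / (2 * ν * s)) =
          (2 * ‖x - x₀‖ ^ 2 + 2 * (4 * C ^ 2 * s * ‖e‖ ^ 2) -
            ‖x - x₀ + galDisp C T t • e‖ ^ 2) / (4 * ν * s) := by
        field_simp
        ring
      rw [hkey]
      exact div_nonneg (by linarith [hw]) (by positivity)
    have := Real.exp_le_exp.2 hexp
    rw [Real.exp_add] at this
    calc A * Real.exp (-(2 * C ^ 2 * ‖e‖ ^ 2 / ν)) * s ^ (-(3 : ℝ) / 2) *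
          Real.exp (-(‖x - x₀‖ ^ 2) / (2 * ν * s))
        = A * s ^ (-(3 : ℝ) / 2) * (Real.exp (-(2 * C ^ 2 * ‖e‖ ^ 2 / ν)) *
          Real.exp (-(‖x - x₀‖ ^ 2) / (2 * ν * s))) := by ring
      _ ≤ A * s ^ (-(3 : ℝ) / 2) * Real.exp (-(‖x - x₀ + galDisp C T t • e‖ ^ 2) / (4 * ν * s)) :=
          mul_le_mul_of_nonneg_left this (by positivity)
  · -- upper bound
    have hexp : -(‖x - x₀ + galDisp C T t • e‖ ^ 2) / (4 * ν * s) ≤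
        C ^ 2 * ‖e‖ ^ 2 / ν + -(‖x - x₀‖ ^ 2) / (8 * ν * s) := by
      rw [← sub_nonneg]
      have hkey : C ^ 2 * ‖e‖ ^ 2 / ν + -(‖x - x₀‖ ^ 2) / (8 * ν * s) -
          -(‖x - x₀ + galDisp C T t • e‖ ^ 2) / (4 * ν * s) =
          (2 * ‖x - x₀ + galDisp C T t • e‖ ^ 2 + 2 * (4 * C ^ 2 * s * ‖e‖ ^ 2) -
            ‖x - x₀‖ ^ 2) / (8 * ν * s) := by
        field_simp
        ring
      rw [hkey]
      exact div_nonneg (by linarith [hz]) (by positivity)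
    have := Real.exp_le_exp.2 hexp
    rw [Real.exp_add] at this
    calc A * s ^ (-(3 : ℝ) / 2) * Real.exp (-(‖x - x₀ + galDisp C T t • e‖ ^ 2) / (4 * ν * s))
        ≤ A * s ^ (-(3 : ℝ) / 2) * (Real.exp (C ^ 2 * ‖e‖ ^ 2 / ν) *
          Real.exp (-(‖x - x₀‖ ^ 2) / (8 * ν * s))) := mul_le_mul_of_nonneg_left this (by positivity)
      _ = A * Real.exp (C ^ 2 * ‖e‖ ^ 2 / ν) * s ^ (-(3 : ℝ) / 2) *
          Real.exp (-(‖x - x₀‖ ^ 2) / (8 * ν * s)) := by ring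

/-- **The Galilean kernel is two-sided Gaussian-comparable** on `(-∞, T)` (hence on every window):
the linear transfer target `C⁺` holds on the Galilean family, with `c₁/C₁ = e^{-3C²‖e‖²/ν}`. -/
theorem isGaussianComparable_gal (hν : 0 < ν) (T : ℝ) (x₀ e : ℝ³) (C : ℝ) :
    IsGaussianComparable (galKernel ν T x₀ e C) (Iio T) T x₀ := by
  rw [isGaussianComparable_iff_fin_three]
  refine ⟨(4 * Real.pi * ν) ^ (-(3 : ℝ) / 2) * Real.exp (-(2 * C ^ 2 * ‖e‖ ^ 2 / ν)), 2 * ν,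
    (4 * Real.pi * ν) ^ (-(3 : ℝ) / 2) * Real.exp (C ^ 2 * ‖e‖ ^ 2 / ν), 8 * ν,
    by positivity, by positivity, by positivity, by positivity, fun t ht x => ?_⟩
  have h := gal_two_sided (C := C) (x₀ := x₀) (e := e) hν (show t < T from ht) x
  rw [show 2 * ν * (T - t) = (2 * ν) * (T - t) by ring,
    show 8 * ν * (T - t) = (8 * ν) * (T - t) by ring] at h
  exact h

/-- **Exponential moments of the Galilean kernel — the moment law is SHARP.** For every `α`,
`∫ e^{⟪α, x - x₀⟫} Γ(t, x) dx = exp(ν(T - t)‖α‖² - 2C√(T - t)⟪α, e⟫)` (complete the square and use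
unit mass of the heat kernel). For `e = -α/‖α‖` this is EXACTLY the bound
`exp(ν‖α‖²(T - t) + 2C‖α‖√(T - t))` of the picked line's `stub_expMoment`
(nash-entropy-last-block; also similarity-ou-harnack-chain's variance/moment calibration), which
therefore cannot be improved on the class. -/
theorem gal_expMoment (hν : 0 < ν) {t : ℝ} (ht : t < T) (α : ℝ³) :
    ∫ x, Real.exp ⟪α, x - x₀⟫ * galKernel ν T x₀ e C t x =
      Real.exp (ν * (T - t) * ‖α‖ ^ 2 - 2 * C * Real.sqrt (T - t) * ⟪α, e⟫) := by
  have hs : 0 < T - t := sub_pos.2 ht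
  set σ : ℝ := ν * (T - t) with hσdef
  have hσ : 0 < σ := mul_pos hν hs
  set c : ℝ³ := x₀ - galDisp C T t • e with hc
  set K : ℝ := (4 * Real.pi * σ) ^ (-(Module.finrank ℝ ℝ³ : ℝ) / 2) with hK
  -- completing the square in the exponent
  have key : ∀ z : ℝ³, ⟪α, z + (c - x₀)⟫ + -(‖z‖ ^ 2) / (4 * σ) =
      (⟪α, c - x₀⟫ + σ * ‖α‖ ^ 2) + -(‖z - (2 * σ) • α‖ ^ 2) / (4 * σ) := by
    intro z
    rw [norm_sub_sq_real, inner_add_right, inner_smul_right, norm_smul, mul_pow, Real.norm_eq_abs,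
      sq_abs, real_inner_comm α z]
    field_simp
    ring
  have hpt : ∀ x, Real.exp ⟪α, x - x₀⟫ * galKernel ν T x₀ e C t x =
      Real.exp (⟪α, c - x₀⟫ + σ * ‖α‖ ^ 2) *
        UnboundedOperators.heatKernel σ (x - (c + (2 * σ) • α)) := by
    intro x
    have hG : galKernel ν T x₀ e C t x = UnboundedOperators.heatKernel σ (x - c) := rfl
    rw [hG]
    simp only [UnboundedOperators.heatKernel]
    rw [← hK, show x - x₀ = (x - c) + (c - x₀) by abel,
      show x - (c + (2 * σ) • α) = (x - c) - (2 * σ) • α by abel]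
    calc Real.exp ⟪α, x - c + (c - x₀)⟫ * (K * Real.exp (-‖x - c‖ ^ 2 / (4 * σ)))
        = K * Real.exp (⟪α, x - c + (c - x₀)⟫ + -(‖x - c‖ ^ 2) / (4 * σ)) := by
          rw [Real.exp_add, neg_div]; ring
      _ = K * Real.exp ((⟪α, c - x₀⟫ + σ * ‖α‖ ^ 2) + -(‖x - c - (2 * σ) • α‖ ^ 2) / (4 * σ)) := by
          rw [key]
      _ = Real.exp (⟪α, c - x₀⟫ + σ * ‖α‖ ^ 2) *
          (K * Real.exp (-‖x - c - (2 * σ) • α‖ ^ 2 / (4 * σ))) := by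
          rw [Real.exp_add, neg_div]; ring
  rw [integral_congr_ae (Eventually.of_forall hpt), integral_const_mul,
    integral_sub_right_eq_self (fun y => UnboundedOperators.heatKernel σ y) (c + (2 * σ) • α),
    UnboundedOperators.integral_heatKernel_eq_one_holds hσ, mul_one]
  congr 1
  rw [hc, hσdef, galDisp]
  simp only [sub_sub_cancel_left, inner_neg_right, inner_smul_right]
  ring

/-- **Sharpness instance.** Along `e = -‖α‖⁻¹ α` the exponential moment of the Galilean kernel
EQUALS `exp(ν‖α‖²(T - t) + 2C‖α‖√(T - t))`, the bound of `stub_expMoment`. -/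
theorem gal_expMoment_sharp (hν : 0 < ν) {t : ℝ} (ht : t < T) {α : ℝ³} (hα : α ≠ 0) :
    ∫ x, Real.exp ⟪α, x - x₀⟫ * galKernel ν T x₀ (-(‖α‖⁻¹) • α) C t x =
      Real.exp (ν * ‖α‖ ^ 2 * (T - t) + 2 * C * ‖α‖ * Real.sqrt (T - t)) := by
  rw [gal_expMoment hν ht]
  congr 1
  have hn : ‖α‖ ≠ 0 := norm_ne_zero_iff.2 hα
  rw [inner_smul_right, real_inner_self_eq_norm_sq]
  field_simp
  ring


/-- Sanity (no kill from this family): under the rate the uniform Type-I drifts DO carry comparable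
adapted kernels on every window `[t₁, T)` — the Galilean member at any `C`. [folklore] -/
theorem linearClaim_gal (hν : 0 < ν) (C : ℝ) {t₁ T : ℝ} (ht₁ : t₁ < T) (e x₀ : ℝ³) :
    ∃ t₀ ∈ Ico t₁ T, ∃ G : ℝ → ℝ³ → ℝ,
      IsAdaptedBackwardKernel ν (uniformVel (galAmp C T) e) (Ico t₀ T) T x₀ G ∧
        IsGaussianComparable G (Ico t₀ T) T x₀ := by
  refine ⟨t₁, ⟨le_rfl, ht₁⟩, galKernel ν T x₀ e C,
    (isAdaptedBackwardKernel_gal hν T x₀ e C).mono Ico_subset_Iio_self (uniqueDiffOn_Ico t₁ T), ?_⟩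
  obtain ⟨c₁, c₂, C₁, C₂, h₁, h₂, h₃, h₄, h⟩ := isGaussianComparable_gal hν T x₀ e C
  exact ⟨c₁, c₂, C₁, C₂, h₁, h₂, h₃, h₄, fun t ht x => h t (show t < T from ht.2) x⟩

end Summit.NavierStokesRegularity.NavierStokesRegularity.Theorems.AdaptedKernelExistsNegative.Galilean

end
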